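import Mathlib
import HarnessLib
import Summits.Ventures.LatticeQCDFlow.Exactness.LeapfrogHMCDoeblin
import Summits.Ventures.LatticeQCDFlow.Exactness.SUNExpChart
import Summits.Ventures.LatticeQCDFlow.Exactness.GroupMetropolisLinkErgodic
import Summits.Ventures.LatticeQCDFlow.Exactness.CabibboMarinariKernel

/-!
# Single-step leapfrog HMC on `SU(N)` lattice gauge fields: the kernel in coordinates of `𝔰𝔲(N)` and its exactness

HONEST FRAMING: exact (Metropolis-corrected) sampling algorithms for lattice gauge theory;
figures of merit are autocorrelation/cost numbers at stated couplings and volumes; no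
continuum-physics claim.

Venture `LatticeQCDFlow` (cell pub-lqcd), topic `Exactness`, FANOUT row 9 (eng-latcore, the
engine `latflow.core.hmc.HMC(f, β, 'leapfrog')` / `sun_2d.HMC2D` on `SU(N)`, `trajectory(τ, nstep = 1)`:
momenta `P_l ∈ 𝔰𝔲(N)` drawn by `sun.random_algebra`, ONE P-first leapfrog step
`P ← P − ½ε∂S`, `U_l ← expm(εP_l) U_l`, `P ← P − ½ε∂S`, Metropolis test on `H = −tr P² + S`).  NEW
WORK of the cell over the tree (`LeapfrogHMCDoeblin.lean` / `SplittingIntegrator.lean` /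
`SplittingWords.lean`: kick, drift, flip, palindromic words, `mulDrift`; `MomentumRefresh.hmc_config_exact`;
`SUNExpChart.lean`: `suExp`; `GroupMetropolisLinkErgodic.gibbsProbability`); nothing here is cited as a
fact.  Printed counterparts, named only: Duane–Kennedy–Pendleton–Roweth 1987; Gottlieb–Liu–
Toussaint–Renken–Sugar 1987 (the gauge-link leapfrog).  This is the `SU(N)` twin of
`SU2LeapfrogHMC.lean` (there: Pauli coordinates on `ℝ³`); here the momenta live in ANY coordinate
space `E` of `𝔰𝔲(N)` (`ι : E →ₗ[ℝ] M_N(ℂ)` with skew-Hermitian traceless values), the kinetic term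
is ANY measurable `T` and the refresh law is its Gibbs law `Z_T⁻¹ e^{−T} dp` over `μ^{⊗links}`,
`μ` an additive Haar measure on `E` (the engine: `T = −Σ_l tr P_l²`, Gaussian momenta).

* §1 `sunExpDrift ι hι ε p = (exp (ε ι p_l))_l` (`sunExpDrift_neg`: time reversal; measurable);
  `sunMomentumWeight μ T = e^{−T} · μ^{⊗links}`, `sunMomentumLaw` (its normalisation; a probability
  law when `0 < Z_T < ∞`: `sunMomentumWeight_univ_ne_zero`, `isProbabilityMeasure_sunMomentumLaw`);
  `isNegInvariant_pi` (`μ^{⊗links}` is symmetric).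
* §2 `sunLeapfrogProposal ε g = flip ∘ K(g) D(e_ε) K(g)` — measurable, an involution, Liouville for
  `Haar^{⊗links} ⊗ μ^{⊗links}`; **`sunLeapfrogHMC`** — THE CONFIGURATION KERNEL
  `refreshUpdate (involMH proposal (S + T)) (sunMomentumLaw μ T)`;
  **`sunLeapfrogHMC_invariant`** — EXACTNESS: it leaves `e^{−S} · Haar^{⊗links}` invariant for every
  measurable `S`, `T` with `Z_T < ∞`, every `ε`, every measurable momentum increment `g` (in the
  engine `−½ε∂S`; its accuracy is irrelevant); `sunLeapfrogHMC_invariant_gibbs` (the normalised law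
  `gibbsProbability Haar^{⊗links} e^{−S}`).

NOT CLAIMED here: ergodicity (next file); `nstep ≥ 2`, OMF words, `tau_jitter`; floating point; the
identification of the engine's Gaussian `random_algebra` draw with `Z⁻¹e^{tr P²}` in these coordinates
(a linear-algebra dictionary, not re-derived here).
-/

noncomputable section

namespace Summit.Ventures.LatticeQCDFlow.Exactness

open MeasureTheory ProbabilityTheory ProbabilityTheory.Kernel Set Metric Function NormedSpace
open Literature.MathematicalPhysics.QuantumFieldTheory (haarProbability)
open scoped ENNReal Matrix

variable {n : Type*} [Fintype n] [DecidableEq n]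
variable {E : Type*} [NormedAddCommGroup E] [NormedSpace ℝ E]
variable (ι : E →ₗ[ℝ] Matrix n n ℂ) (hι : ∀ a, (ι a)ᴴ = -ι a ∧ (ι a).trace = 0)
variable {L : Type*}

/-! ## §1 Drift factors and the proposal map (no measurability needed) -/

section Algebra

/-- **The link drift factors** `e_ε(p)_l = exp (ε ι p_l) ∈ SU(N)` (the engine's `U ← expm(εP) U`). -/
def sunExpDrift (ε : ℝ) (p : L → E) : L → Matrix.specialUnitaryGroup n ℂ := fun l => suExp ι hι (ε • p l)

/-- The drift factor at a link. -/
@[simp] theorem sunExpDrift_apply (ε : ℝ) (p : L → E) (l : L) : sunExpDrift ι hι ε p l = suExp ι hι (ε • p l) := rfl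

/-- Time reversal of the drift: `e_ε(−p) = e_ε(p)⁻¹`. -/
theorem sunExpDrift_neg (ε : ℝ) (p : L → E) : sunExpDrift ι hι ε (-p) = (sunExpDrift ι hι ε p)⁻¹ := by
  funext l
  simp only [sunExpDrift, Pi.neg_apply, Pi.inv_apply, smul_neg]
  exact suExp_neg ι hι _

variable (ε : ℝ) (g : (L → Matrix.specialUnitaryGroup n ℂ) → L → E)

/-- **The proposal map**: ONE P-first leapfrog step `K(g) D(e_ε) K(g)` followed by the momentum flip
(`g` = the momentum increment of a half kick, in the engine `−½ε ∂S`). -/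
def sunLeapfrogProposal : Equiv.Perm ((L → Matrix.specialUnitaryGroup n ℂ) × (L → E)) :=
  flip * palindromicWord [kick g] (drift (mulDrift (sunExpDrift ι hι ε))) ^ 1

/-- The proposal map is an involution (time reversal of the palindromic word). -/
theorem involutive_sunLeapfrogProposal : Function.Involutive (⇑(sunLeapfrogProposal ι hι ε g)) :=
  (palindromicWord_pow_isFlipReversible flip_mul_flip
    (drift_isFlipReversible (mulDrift_reversal (sunExpDrift_neg ι hι ε)))
    (fun A hA => by rw [List.mem_singleton] at hA; subst hA; exact kick_isFlipReversible g) 1).involutive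

end Algebra

/-! ## §2 Momentum weight and refresh law; measurability, Liouville, the kernel, exactness -/

section Kernel

variable [MeasurableSpace E] [BorelSpace E]

/-- The drift factors depend measurably on the momenta. -/
theorem measurable_sunExpDrift [FiniteDimensional ℝ E] [Countable L] (ε : ℝ) :
    Measurable (sunExpDrift (L := L) ι hι ε) :=
  measurable_pi_lambda _ fun l =>
    ((continuous_suExp ι hι).comp (continuous_const_smul ε)).measurable.comp (measurable_pi_apply l)

variable [Fintype L] (μ : Measure E) (T : (L → E) → ℝ)

/-- **The un-normalised momentum weight** `e^{−T(p)} · μ^{⊗links}`. -/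
def sunMomentumWeight : Measure (L → E) :=
  (Measure.pi fun _ : L => μ).withDensity fun p => ENNReal.ofReal (Real.exp (-T p))

/-- **The momentum refresh law** `Z_T⁻¹ e^{−T} · μ^{⊗links}`. -/
def sunMomentumLaw : Measure (L → E) := (sunMomentumWeight μ T univ)⁻¹ • sunMomentumWeight μ T

omit [BorelSpace E] in
/-- `Z_T ≠ 0` (the weight is positive and `μ^{⊗links}` charges the whole space). -/
theorem sunMomentumWeight_univ_ne_zero [FiniteDimensional ℝ E] [μ.IsAddHaarMeasure] (hT : Measurable T) :
    sunMomentumWeight (L := L) μ T univ ≠ 0 := by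
  rw [sunMomentumWeight, withDensity_apply _ MeasurableSet.univ, Measure.restrict_univ]
  intro h
  have hmeas : Measurable fun p : L → E => ENNReal.ofReal (Real.exp (-T p)) :=
    (Real.measurable_exp.comp hT.neg).ennreal_ofReal
  rw [lintegral_eq_zero_iff hmeas] at h
  have huniv : (Measure.pi fun _ : L => μ) univ ≠ 0 := (isOpen_univ.measure_pos _ univ_nonempty).ne'
  have hae : ∀ᵐ p ∂(Measure.pi fun _ : L => μ), False := by
    filter_upwards [Filter.EventuallyEq.eventually h] with p hp
    have h0 : (0 : ℝ≥0∞) < ENNReal.ofReal (Real.exp (-T p)) := ENNReal.ofReal_pos.2 (Real.exp_pos _)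
    rw [hp, Pi.zero_apply] at h0
    exact lt_irrefl _ h0
  rw [Filter.eventually_false_iff_eq_bot, ae_eq_bot] at hae
  exact huniv (by rw [hae]; rfl)

omit [BorelSpace E] in
/-- The refresh law is a probability law when `Z_T < ∞`. -/
theorem isProbabilityMeasure_sunMomentumLaw [FiniteDimensional ℝ E] [μ.IsAddHaarMeasure] (hT : Measurable T)
    (hZ : sunMomentumWeight (L := L) μ T univ ≠ ⊤) : IsProbabilityMeasure (sunMomentumLaw (L := L) μ T) :=
  ⟨by rw [sunMomentumLaw, Measure.smul_apply, smul_eq_mul,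
    ENNReal.inv_mul_cancel (sunMomentumWeight_univ_ne_zero μ T hT) hZ]⟩

/-- The refresh law is `s`-finite. -/
instance sFinite_sunMomentumLaw [SFinite μ] : SFinite (sunMomentumLaw (L := L) μ T) := by
  unfold sunMomentumLaw sunMomentumWeight; infer_instance

/-- `μ^{⊗links}` is symmetric under `p ↦ −p` (an additive Haar measure on a finite-dimensional space). -/
theorem isNegInvariant_pi [FiniteDimensional ℝ E] [μ.IsAddHaarMeasure] :
    (Measure.pi fun _ : L => μ).IsNegInvariant :=
  haveI : (Measure.pi fun _ : L => μ).Regular := Measure.Regular.of_sigmaCompactSpace_of_isLocallyFiniteMeasure _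
  Measure.IsAddHaarMeasure.isNegInvariant_of_regular _

variable (ε : ℝ) {g : (L → Matrix.specialUnitaryGroup n ℂ) → L → E}

omit [Fintype L] in
/-- The proposal map is measurable (for measurable `g`). -/
theorem measurable_sunLeapfrogProposal [FiniteDimensional ℝ E] [Countable L] (hg : Measurable g) :
    Measurable (⇑(sunLeapfrogProposal ι hι ε g)) := by
  rw [sunLeapfrogProposal, pow_one, palindromicWord_kick_drift, Equiv.Perm.coe_mul, Equiv.Perm.coe_mul,
    Equiv.Perm.coe_mul]
  exact measurable_flip.comp ((measurable_kick hg).comp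
    ((measurable_drift (measurable_mulDrift (measurable_sunExpDrift ι hι ε))).comp (measurable_kick hg)))

/-- The proposal map preserves `Haar^{⊗links} ⊗ μ^{⊗links}` (Liouville). -/
theorem measurePreserving_sunLeapfrogProposal [FiniteDimensional ℝ E] [μ.IsAddHaarMeasure] (hg : Measurable g) :
    MeasurePreserving (⇑(sunLeapfrogProposal ι hι ε g))
      ((Measure.pi fun _ : L => haarProbability (Matrix.specialUnitaryGroup n ℂ)).prod (Measure.pi fun _ : L => μ))
      ((Measure.pi fun _ : L => haarProbability (Matrix.specialUnitaryGroup n ℂ)).prod (Measure.pi fun _ : L => μ)) := by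
  haveI := isNegInvariant_pi (L := L) μ
  rw [sunLeapfrogProposal, Equiv.Perm.coe_mul]
  exact measurePreserving_flip.comp (measurePreserving_perm_pow
    (measurePreserving_palindromicWord
      (measurePreserving_drift (measurable_mulDrift (measurable_sunExpDrift ι hι ε))
        (measurePreserving_mulDrift (sunExpDrift ι hι ε)))
      (fun A hA => by rw [List.mem_singleton] at hA; subst hA; exact measurePreserving_kick hg)) 1)

/-- **THE CONFIGURATION KERNEL** (`hmc.HMC(f, β, 'leapfrog').trajectory(τ = ε, nstep = 1)` on `SU(N)`):
refresh `p ∼ Z_T⁻¹e^{−T}`, one P-first leapfrog step, flip, Metropolis test on `S + T`, forget `p`. -/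
def sunLeapfrogHMC [FiniteDimensional ℝ E] (hg : Measurable g)
    (S : (L → Matrix.specialUnitaryGroup n ℂ) → ℝ) :
    Kernel (L → Matrix.specialUnitaryGroup n ℂ) (L → Matrix.specialUnitaryGroup n ℂ) :=
  refreshUpdate
    (involMH (⇑(sunLeapfrogProposal ι hι ε g)) (measurable_sunLeapfrogProposal ι hι ε hg)
      fun z => S z.1 + T z.2)
    (sunMomentumLaw μ T)

variable {ε μ T}

/-- **EXACTNESS**: the kernel leaves `e^{−S} · Haar^{⊗links}` invariant, for every measurable `S`, every
measurable `T` with `Z_T < ∞`, every `ε`, every measurable `g`. -/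
theorem sunLeapfrogHMC_invariant [FiniteDimensional ℝ E] [μ.IsAddHaarMeasure] (hg : Measurable g) (hT : Measurable T)
    (hZ : sunMomentumWeight (L := L) μ T univ ≠ ⊤) {S : (L → Matrix.specialUnitaryGroup n ℂ) → ℝ} (hS : Measurable S) :
    Invariant (sunLeapfrogHMC ι hι μ T ε hg S)
      ((Measure.pi fun _ : L => haarProbability (Matrix.specialUnitaryGroup n ℂ)).withDensity
        fun u => ENNReal.ofReal (Real.exp (-S u))) :=
  hmc_config_exact (vol := Measure.pi fun _ : L => haarProbability (Matrix.specialUnitaryGroup n ℂ))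
    (volP := Measure.pi fun _ : L => μ) (hΦ := measurable_sunLeapfrogProposal ι hι ε hg) hS hT
    (involutive_sunLeapfrogProposal ι hι ε g) (measurePreserving_sunLeapfrogProposal ι hι μ ε hg)
    (sunMomentumWeight_univ_ne_zero μ T hT) hZ

/-- **… hence the normalised Gibbs law `gibbsProbability Haar^{⊗links} e^{−S}` is invariant.** -/
theorem sunLeapfrogHMC_invariant_gibbs [FiniteDimensional ℝ E] [μ.IsAddHaarMeasure] (hg : Measurable g)
    (hT : Measurable T) (hZ : sunMomentumWeight (L := L) μ T univ ≠ ⊤)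
    {S : (L → Matrix.specialUnitaryGroup n ℂ) → ℝ} (hS : Measurable S) :
    Invariant (sunLeapfrogHMC ι hι μ T ε hg S)
      (gibbsProbability (Measure.pi fun _ : L => haarProbability (Matrix.specialUnitaryGroup n ℂ))
        fun u => Real.exp (-S u)) :=
  invariant_gibbsProbability (sunLeapfrogHMC_invariant ι hι hg hT hZ hS)

end Kernel

end Summit.Ventures.LatticeQCDFlow.Exactness
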